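import Literature.NumberTheory.LFunctions.ZetaScrewNullSeriesProofs
import Literature.NumberTheory.LFunctions.ZetaScrewEq301Proofs
import Literature.NumberTheory.LFunctions.ZetaScrewLemma21Proofs
import Literature.NumberTheory.LFunctions.ZetaScrewHermitianFormsProofs
import Literature.NumberTheory.LFunctions.YoshidaCompletedFormDegeneracy
import HarnessLib

/-!
# Suzuki JLMS 2023, Theorem 6.1 modulo Theorem 1.4 — PROOFS (assembly)

LINE 1 — LABEL: RH-FREE corpus (proof-only assembly module: no definition, no named fact).
Suzuki2023 Thm 6.1 = the named fact `Suzuki2023_thm61` of `ZetaScrewGrowthMoments.lean`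
("Suppose that the RH is false. Then there exist `a₀ > 0` and a non-identically vanishing `{w_γ}`
with `Σ_γ w_γ(e^{iγt} − 1)/γ² = 0` on `(−a₀,a₀)`") is shown here to be INTERIOR to the corpus: it
follows from the sufficiency half of Thm 1.4 (`Suzuki2023_thm14`, RH-EQUIVALENT·PRINTED, Yoshida's
strategy §5.2 — NOT in the tree, taken as the hypothesis) and the RH-FREE null-series theorem of
§6.2 (`ZetaScrewNullSeries.exists_nullSeries_of_not_nondegenerate`, sibling
`ZetaScrewNullSeriesProofs.lean`), with the tree theorems (3.1) (`Suzuki2023_eq301`) and Lemma 2.1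
(`Suzuki2023_lemma21_holds`) plugged in. bears_on: LADDER-RH B-C/B-P (COLUMN 6, de Branges–Suzuki
corpus). WHAT THIS IS NOT: no degeneracy of Suzuki's `L²(−a, a)`-form is asserted (Thm 1.4 `⟸`
stays a named fact); Thm 6.1 is an implication with hypothesis `¬RH` and asserts nothing about the
zeros of `ζ`; nothing here bears on the truth of RH.

UPDATE (2026-08-26, seat rh-crit-dbl-t8 g3): **`Suzuki2023_thm61` IS NOW DISCHARGED** (`Suzuki2023_thm61_holds`,
last section) WITHOUT Thm 1.4 `⟸`: from Yoshida's completed-space degeneracy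
(`completedWeilForm_degenerate_of_not_riemannHypothesis`, `YoshidaCompletedForm.hasSum_zeroSide_radical` of
`YoshidaCompletedFormDegeneracy.lean`) — under `¬RH` a unit null vector `ξ₀ ∈ K̂(a₀)` of the completed Weil
form exists and its zero-values annihilate every test function of the window; tested against the
differences `φ − φ(· − t)` of a narrow bump this is exactly a null series of the printed shape with
weights `w(ρ) = m(ρ) ξ̂₀(ρ) conj φ̂(1−ρ̄) (ρ−½)²`, not all zero.

Source: M. Suzuki, *Aspects of the screw function corresponding to the Riemann zeta-function*,
J. Lond. Math. Soc. (2) 108 (2023) 1448–1487 = arXiv:2206.03682 [Suzuki2023], §6.2 and Thm 6.1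
(held text p0016:L150–167: "By Theorem 1.4, `λ = 0` is actually an eigenvalue when the RH is false.
Therefore, we obtain the following result …").

## Contents

* `exists_nullSeries_of_not_isScrewFormNondegenerate` — degeneracy of `⟨·,·⟩_{G_g,a}` on
  `L²(−a,a)` ⟹ a non-trivial null series on `(−a,a)` (RH-FREE, unconditional; §6.2);
* `exists_nullSeries_of_eigenvalue_zero` — the same from "`0` is an eigenvalue of `𝖦_g[a]`"
  (`Suzuki2023_thm14_eigenvalue_holds`), the printed formulation;
* `Suzuki2023_thm61_of_thm14_mpr`, `Suzuki2023_thm61_of_thm14` — Thm 6.1 from the `⟸` half of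
  Thm 1.4, resp. from the named fact `Suzuki2023_thm14`.
* `Suzuki2023_thm61_holds` — **Thm 6.1 discharged** (via Yoshida's completed-space null vector; see
  the UPDATE above).

## References

* M. Suzuki, J. Lond. Math. Soc. (2) 108 (2023); arXiv:2206.03682, §6.2, Thm 6.1, Thm 1.4. [Suzuki2023]
* H. Yoshida, Adv. Stud. Pure Math. 21 (1992) 281–325, Thm. 2 (p. 321). [Yoshida1992HermitianForms]
-/

noncomputable section

open MeasureTheory Set Filter Complex Topology
open scoped ComplexConjugate

namespace Literature.NumberTheory.LFunctions

/-- RH-FREE · **Suzuki2023 §6.2 (the content of Thm 6.1), unconditional form**: if `⟨·,·⟩_{G_g,a}` is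
degenerate on `L²(−a,a)`, there is `w ≠ 0` on the zero multiset with
`Σ_ρ w(ρ)(1 − e^{−(ρ−½)t})/(ρ−½)² = 0` for every `t ∈ (−a,a)` — the sibling's
`ZetaScrewNullSeries.exists_nullSeries_of_not_nondegenerate` with (3.1) (`Suzuki2023_eq301`) and
Lemma 2.1 (`Suzuki2023_lemma21_holds`) plugged in. [cite: Suzuki2023, §6.2, p. 16] -/
theorem exists_nullSeries_of_not_isScrewFormNondegenerate {a : ℝ}
    (hdeg : ¬ IsScrewFormNondegenerate a) :
    ∃ w : ZetaZeros.riemannZetaNontrivialZeros → ℂ, w ≠ 0 ∧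
      ∀ t : ℝ, t ∈ Ioo (-a) a →
        HasSum (fun ρ : ZetaZeros.riemannZetaNontrivialZeros ↦
          w ρ * ((1 - cexp (-((ρ : ℂ) - 1 / 2) * t)) / ((ρ : ℂ) - 1 / 2) ^ 2)) 0 :=
  ZetaScrewNullSeries.exists_nullSeries_of_not_nondegenerate Suzuki2023_lemma21_holds
    (fun h₁ h₂ ↦ Suzuki2023_eq301 h₁ h₂) hdeg

/-- RH-FREE · **Suzuki2023 §6.2, printed formulation**: if `0` is an eigenvalue of `𝖦_g[a]`
(`0 < a`; some `0 ≠ φ ∈ L²(−a,a)` with `𝖦_g[a]φ = 0` a.e.), then a non-trivial null series holds on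
`(−a,a)` ("if `λ = 0`, we have `Σ_γ w_γ(e^{iγt} − 1)/γ² = 0` for `t ∈ (−a,a)` … `w_γ ≠ 0` for some
`γ` by Lemma 2.1"). Via `Suzuki2023_thm14_eigenvalue_holds`. [cite: Suzuki2023, §6.2, p. 16] -/
theorem exists_nullSeries_of_eigenvalue_zero {a : ℝ} (ha : 0 < a)
    (φ : Lp ℂ 2 (volume.restrict (Ioo (-a) a))) (hφ : φ ≠ 0)
    (h0 : zetaScrewOp (Ioo (-a) a) φ =ᵐ[volume.restrict (Ioo (-a) a)] 0) :
    ∃ w : ZetaZeros.riemannZetaNontrivialZeros → ℂ, w ≠ 0 ∧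
      ∀ t : ℝ, t ∈ Ioo (-a) a →
        HasSum (fun ρ : ZetaZeros.riemannZetaNontrivialZeros ↦
          w ρ * ((1 - cexp (-((ρ : ℂ) - 1 / 2) * t)) / ((ρ : ℂ) - 1 / 2) ^ 2)) 0 :=
  exists_nullSeries_of_not_isScrewFormNondegenerate fun hnd ↦
    hφ ((Suzuki2023_thm14_eigenvalue_holds a ha).1 hnd φ h0)

/-- **Suzuki2023 Thm 6.1 from the sufficiency half of Thm 1.4** (the printed derivation: "By
Theorem 1.4, `λ = 0` is actually an eigenvalue when the RH is false", then §6.2): if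
"`⟨·,·⟩_{G_g,a}` non-degenerate on `L²(−a,a)` for every `0 < a`" implies RH, then `Suzuki2023_thm61`
holds. RH-FREE implication between printed statements; the hypothesis is the `⟸` half of the
named fact `Suzuki2023_thm14` (Yoshida's strategy, §5.2, not in the tree).
[cite: Suzuki2023, Thm 6.1 and §6.2, p. 16; Thm 1.4, p. 3] -/
theorem Suzuki2023_thm61_of_thm14_mpr
    (h14 : (∀ a : ℝ, 0 < a → IsScrewFormNondegenerate a) → RiemannHypothesis) :
    Suzuki2023_thm61 := by
  intro hRH
  obtain ⟨a, ha, hdeg⟩ : ∃ a : ℝ, 0 < a ∧ ¬ IsScrewFormNondegenerate a := by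
    by_contra hcon
    exact hRH (h14 fun a ha ↦ by
      by_contra hd
      exact hcon ⟨a, ha, hd⟩)
  obtain ⟨w, hw, hs⟩ := exists_nullSeries_of_not_isScrewFormNondegenerate hdeg
  exact ⟨a, ha, w, hw, hs⟩

/-- **Suzuki2023 Thm 6.1 modulo Thm 1.4** (`Suzuki2023_thm14`, the named fact): `Suzuki2023_thm61`
is INTERIOR to the corpus — a tree theorem as soon as Thm 1.4 is. [cite: Suzuki2023, Thm 6.1, p. 16] -/
theorem Suzuki2023_thm61_of_thm14 (h14 : Suzuki2023_thm14) : Suzuki2023_thm61 :=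
  Suzuki2023_thm61_of_thm14_mpr h14.mpr

/-! ## Thm 6.1 discharged: Yoshida's completed-space null vector gives Suzuki's null series -/

section Discharge

open ConnesConsani2023 YoshidaCompletedForm

/-- A test function supported in a prescribed interval whose transform does not vanish at a
prescribed point (a narrow bump around the centre: `|∫ φ (e^{μx} − e^{μx₀})| < |e^{μx₀}| ∫ φ`). [folklore] -/
private theorem exists_isWeilTest_weilMellin_ne_zero (x₀ : ℝ) {r : ℝ} (hr : 0 < r) (s : ℂ) :
    ∃ φ : ℝ → ℂ, IsWeilTest φ ∧ tsupport φ ⊆ Icc (x₀ - r) (x₀ + r) ∧ weilMellin φ s ≠ 0 := by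
  set μ : ℂ := s - 1 / 2 with hμ
  have hcont : ContinuousAt (fun x : ℝ ↦ cexp (μ * x)) x₀ := by fun_prop
  have hE : 0 < ‖cexp (μ * x₀)‖ := norm_pos_iff.2 (Complex.exp_ne_zero _)
  obtain ⟨δ, hδ, hδε⟩ := Metric.continuousAt_iff.1 hcont (‖cexp (μ * x₀)‖ / 2) (by positivity)
  set r' : ℝ := min (δ / 2) r with hr'
  have hr'pos : 0 < r' := by positivity
  have hr'δ : r' < δ := lt_of_le_of_lt (min_le_left _ _) (by linarith)
  have hr'r : r' ≤ r := min_le_right _ _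
  let β : ContDiffBump x₀ := ⟨r' / 2, r', by positivity, by linarith⟩
  set φ : ℝ → ℂ := fun x ↦ ((β x : ℝ) : ℂ) with hφ
  have hφt : IsWeilTest φ :=
    ⟨Complex.ofRealCLM.contDiff.comp β.contDiff, β.hasCompactSupport.comp_left Complex.ofReal_zero⟩
  have hφs : tsupport φ ⊆ Metric.closedBall x₀ r' := by
    refine (tsupport_comp_subset Complex.ofReal_zero _).trans ?_
    rw [β.tsupport_eq]
  have hφs' : tsupport φ ⊆ Icc (x₀ - r) (x₀ + r) := by
    refine hφs.trans ?_
    rw [Real.closedBall_eq_Icc]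
    exact Icc_subset_Icc (by linarith) (by linarith)
  refine ⟨φ, hφt, hφs', fun h0 ↦ ?_⟩
  -- `∫ φ > 0`
  have hIpos : 0 < ∫ x, β x := β.integral_pos
  -- the transform splits as `e^{μ x₀} ∫ φ + ∫ φ (e^{μ x} − e^{μ x₀})`
  have hint : Integrable (fun x : ℝ ↦ ((β x : ℝ) : ℂ) * cexp (μ * x)) := by
    refine (hφt.1.continuous.mul (by fun_prop)).integrable_of_hasCompactSupport ?_
    exact hφt.2.mul_right
  have hintβ : Integrable (fun x : ℝ ↦ ((β x : ℝ) : ℂ)) :=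
    hφt.1.continuous.integrable_of_hasCompactSupport hφt.2
  have hsplit : weilMellin φ s = cexp (μ * x₀) * (∫ x, ((β x : ℝ) : ℂ)) +
      ∫ x, ((β x : ℝ) : ℂ) * (cexp (μ * x) - cexp (μ * x₀)) := by
    have e1 : weilMellin φ s = ∫ x, ((β x : ℝ) : ℂ) * cexp (μ * x) := by
      unfold weilMellin
      refine integral_congr_ae (Eventually.of_forall fun x ↦ ?_)
      simp only [hφ, hμ]
    rw [e1, ← integral_const_mul, ← integral_add (hintβ.const_mul _) ?_]
    · refine integral_congr_ae (Eventually.of_forall fun x ↦ ?_)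
      simp only
      ring
    · exact (hint.sub (hintβ.mul_const _)).congr (Eventually.of_forall fun x ↦ by simp only [Pi.sub_apply]; ring)
  -- the error integral is small
  have herr : ‖∫ x, ((β x : ℝ) : ℂ) * (cexp (μ * x) - cexp (μ * x₀))‖ ≤
      (‖cexp (μ * x₀)‖ / 2) * ∫ x, β x := by
    have hb : ∀ x, ‖((β x : ℝ) : ℂ) * (cexp (μ * x) - cexp (μ * x₀))‖ ≤
        (‖cexp (μ * x₀)‖ / 2) * β x := by
      intro x
      rw [norm_mul, Complex.norm_real, Real.norm_of_nonneg (β.nonneg' x), mul_comm]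
      by_cases hx : x ∈ Metric.ball x₀ δ
      · exact mul_le_mul_of_nonneg_right (le_of_lt (by simpa [dist_eq_norm] using hδε hx))
          (β.nonneg' x)
      · have hβ0 : β x = 0 := by
          apply β.zero_of_le_dist
          have : δ ≤ dist x x₀ := by simpa [Metric.mem_ball] using hx
          linarith
        rw [hβ0, mul_zero, mul_zero]
    refine (norm_integral_le_of_norm_le ((β.integrable).const_mul _) (Eventually.of_forall hb)).trans ?_
    rw [integral_const_mul]
  -- contradiction with `weilMellin φ s = 0`
  rw [h0] at hsplit
  have hmain : ‖cexp (μ * x₀) * (∫ x, ((β x : ℝ) : ℂ))‖ = ‖cexp (μ * x₀)‖ * ∫ x, β x := by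
    rw [norm_mul, integral_complex_ofReal, Complex.norm_real, Real.norm_of_nonneg hIpos.le]
  have h1 : ‖cexp (μ * x₀) * (∫ x, ((β x : ℝ) : ℂ))‖ =
      ‖∫ x, ((β x : ℝ) : ℂ) * (cexp (μ * x) - cexp (μ * x₀))‖ := by
    have : cexp (μ * x₀) * (∫ x, ((β x : ℝ) : ℂ)) =
        -∫ x, ((β x : ℝ) : ℂ) * (cexp (μ * x) - cexp (μ * x₀)) := by
      linear_combination hsplit.symm
    rw [this, norm_neg]
  rw [hmain] at h1
  have : ‖cexp (μ * x₀)‖ * ∫ x, β x ≤ (‖cexp (μ * x₀)‖ / 2) * ∫ x, β x := h1 ▸ herr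
  nlinarith

/-- **DISCHARGE of `Suzuki2023_thm61` (Su23 J. Lond. Math. Soc. Thm. 6.1)** — NOT via the sufficiency half
of Thm. 1.4 (whose printed §5.2 argument is not formalized), but from Yoshida's completed-space
degeneracy: under `¬RH` there is a unit null vector `ξ₀ ∈ K̂(a₀)` of the completed Weil form at the
threshold (`completedWeilForm_degenerate_of_not_riemannHypothesis`), whose zero-values annihilate every
test function of the window (`YoshidaCompletedForm.hasSum_zeroSide_radical`); testing against the
differences `h_t = φ − φ(· − t)` of a narrow bump `φ` (`ĥ_t(s) = φ̂(s)(1 − e^{(s−½)t})`) gives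
`Σ_ρ w(ρ) (1 − e^{−(ρ−½)t})/(ρ−½)² = 0` on `(−a₀/2, a₀/2)` with the weights
`w(ρ) = m(ρ) ξ̂₀(ρ) conj φ̂(1−ρ̄) (ρ−½)²`, not all zero (`ξ̂₀(ρ₀) ≠ 0` for some zero `ρ₀`, and `φ` is
chosen with `φ̂(1−ρ̄₀) ≠ 0`).  This is §6.2's derivation with Yoshida's `ψ`-variable null vector in
place of the `L²(−a₀, a₀)` eigenfunction. [cite: Suzuki2023, Thm. 6.1 and §6.2 (p. 16); Yoshida1992HermitianForms, Thm. 2 (p. 321)] -/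
theorem Suzuki2023_thm61_holds : Suzuki2023_thm61 := by
  intro hRH
  obtain ⟨ξ₀, hξ₀D, -, ⟨ρ₀, hρ₀, hne⟩, hrad⟩ :=
    exists_zeroSide_null_relation_of_not_riemannHypothesis hRH
  set a₀ := weilPositivityThreshold with ha₀def
  have ha₀ : 0 < a₀ := lt_of_lt_of_le (by positivity) (Yoshida1992_prop6 hRH).1
  -- the bump `φ`, supported in `[a₀/8, 3a₀/8] ⊂ (0, a₀/2)`, with `φ̂(1 − ρ̄₀) ≠ 0`
  obtain ⟨φ, hφt, hφs, hφne⟩ :=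
    exists_isWeilTest_weilMellin_ne_zero (a₀ / 4) (by positivity : 0 < a₀ / 8) (1 - conj ρ₀)
  -- the weights
  set A : ZetaZeros.riemannZetaNontrivialZeros → ℂ := fun ρ ↦ conj (weilMellin φ (1 - conj (ρ : ℂ)))
    with hA
  set w : ZetaZeros.riemannZetaNontrivialZeros → ℂ := fun ρ ↦
    (riemannZetaZeroOrder (ρ : ℂ) : ℂ) * weilMellin ξ₀ ρ * A ρ * ((ρ : ℂ) - 1 / 2) ^ 2 with hw
  have hmem := fun (ρ : ZetaZeros.riemannZetaNontrivialZeros) ↦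
    (mem_riemannZetaNontrivialZeros_iff_holds).1 ρ.2
  have hl : ∀ ρ : ZetaZeros.riemannZetaNontrivialZeros, (ρ : ℂ) - 1 / 2 ≠ 0 := by
    intro ρ h
    obtain ⟨hζ, h0, h1⟩ := hmem ρ
    have him := im_ne_zero_of_riemannZeta_eq_zero hζ h0 h1
    have : (ρ : ℂ).im = 0 := by
      have := congrArg Complex.im h
      simpa using this
    exact him this
  refine ⟨a₀ / 2, by positivity, w, ?_, fun t ht ↦ ?_⟩
  · -- `w ≠ 0`: the `ρ₀` coordinate
    intro hw0
    have h := congrFun hw0 ⟨ρ₀, hρ₀⟩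
    obtain ⟨hζ, h0, h1⟩ := (mem_riemannZetaNontrivialZeros_iff_holds).1 hρ₀
    have hm : (riemannZetaZeroOrder ρ₀ : ℂ) ≠ 0 := by
      have hne1 : ρ₀ ≠ 1 := by
        rintro rfl; simp at h1
      exact_mod_cast ((riemannZetaZeroOrder_pos_iff hne1).2 hζ).ne'
    simp only [hw, hA, Pi.zero_apply, mul_eq_zero, pow_eq_zero_iff two_ne_zero,
      map_eq_zero] at h
    rcases h with ((h | h) | h) | h
    · exact hm h
    · exact hne h
    · exact hφne h
    · exact hl ⟨ρ₀, hρ₀⟩ h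
  · -- the null series at `t`: the radical identity for `h_t = φ − φ(· − t)`
    simp only [mem_Ioo] at ht
    set h : ℝ → ℂ := φ + fun x ↦ (-1 : ℂ) * weilTranslate φ t x with hh
    have hht : IsWeilTest h := hφt.add ((hφt.weilTranslate t).const_mul (-1))
    have htr : tsupport (weilTranslate φ t) ⊆ Icc (a₀ / 4 - a₀ / 8 + t) (a₀ / 4 + a₀ / 8 + t) := by
      refine closure_minimal (fun x hx ↦ ?_) isClosed_Icc
      have hx' : x - t ∈ tsupport φ := subset_tsupport _ (by simpa [weilTranslate] using hx)
      have := hφs hx'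
      simp only [mem_Icc] at this ⊢
      constructor <;> linarith
    have hhs : tsupport h ⊆ Icc (-a₀) a₀ := by
      refine (tsupport_add _ _).trans (union_subset (hφs.trans (Icc_subset_Icc (by linarith)
        (by linarith))) (tsupport_mul_subset_right.trans (htr.trans (Icc_subset_Icc (by linarith)
        (by linarith)))))
    have hsum := hrad h hht hhs
    -- the transform of `h`
    have hmel : ∀ s : ℂ, weilMellin h s = weilMellin φ s * (1 - cexp ((s - 1 / 2) * t)) := by
      intro s
      have hc : IsWeilTest fun x ↦ (-1 : ℂ) * weilTranslate φ t x := (hφt.weilTranslate t).const_mul _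
      rw [hh, weilMellin_add hφt.1.continuous hφt.2 hc.1.continuous hc.2, weilMellin_const_mul,
        weilMellin_weilTranslate]
      ring
    refine hsum.congr_fun fun ρ ↦ ?_
    -- termwise algebra: `w ρ · (1 − e^{−λt})/λ² = m ξ̂₀(ρ) conj ĥ(1 − ρ̄)`
    have hlρ := hl ρ
    have hE : conj (cexp ((1 - conj (ρ : ℂ) - 1 / 2) * (t : ℂ))) = cexp (-((ρ : ℂ) - 1 / 2) * t) := by
      rw [← Complex.exp_conj, map_mul, Complex.conj_ofReal, map_sub, map_sub, map_one,
        Complex.conj_conj, show conj (1 / 2 : ℂ) = 1 / 2 by rw [map_div₀, map_one, map_ofNat]]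
      congr 1
      ring
    have key : ((ρ : ℂ) - 1 / 2) ^ 2 * ((1 - cexp (-((ρ : ℂ) - 1 / 2) * t)) / ((ρ : ℂ) - 1 / 2) ^ 2) =
        1 - cexp (-((ρ : ℂ) - 1 / 2) * t) := by
      rw [← mul_div_assoc, mul_div_cancel_left₀ _ (pow_ne_zero 2 hlρ)]
    rw [hmel, map_mul, map_sub, map_one, hE]
    simp only [hw, hA]
    rw [show ∀ X Y Z W V : ℂ, X * Y * Z * W * V = X * (Y * (Z * (W * V))) from
      fun _ _ _ _ _ ↦ by ring, key]

end Discharge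

end Literature.NumberTheory.LFunctions

end
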